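import Literature.NumberTheory.EllipticCurves.IwasawaLeadingTerm
import Literature.NumberTheory.EllipticCurves.PadicSigmaSq
import Literature.NumberTheory.EllipticCurves.Greenberg1999.TwoTorsionMuInvariant
import HarnessLib

/-!
# Cell `bsd-f1-sign2` / route AlignedTransportAtTwo, crux C3′ `BSDOfMainConjectureRankOneAtTwo` (stmt-BirchSwinnertonDyer-23008):
# T-23008-a `SchneiderLeadingTermAtTwoSq` (Schneider / BMS Thm 1.7 shape AT `p = 2` over the `Σ²` height receptacle) and
# T-23008-b `PerrinRiouComparisonAtTwo` (Perrin-Riou's rank-one comparison AT `p = 2`), ONE currency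

STATEMENTS ONLY (two `@[conjecture] def`s = open obligations at `2`, nothing asserted) + TYPER GLUE (the per-curve predicates `…At W` — definitional —
with `Iff.rfl` unfoldings and projections PROVED; the kernel check that the pair closes stub L of the crux lives in the lead's workfile / Theorems/
(p595308); no named Literature fact, no `sorry`).

TYPER FILING (seat `bsd-f1-sign2-ty` g4; CANDIDATES.md rows T-23008-a / T-23008-b): bodies VERBATIM from the C3′ lead's tree workfile
`Summits/BirchSwinnertonDyer/BirchSwinnertonDyer/Cruxes/BSDOfMainConjectureRankOneAtTwo/Lines/birth_typing_draft.lean` e4417554c2bcaee2 (seat bsd-line-att-p1 g2,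
2026-08-28T01:50:00Z, commit 684feaee37d2; rc 0 / 0 sorry; its `bsdOfMainConjectureRankOneAtTwo_of_drafts` PROVES (a) → (b) → GZK → modularity datum →
Mazur–Tate Σ² fact → `BSDOfMainConjectureRankOneAtTwo`, i.e. the crux is CLOSED MODULO exactly these two statements + 3 PRINT facts); typing asks
T-23008-a/b of `Lines/birth.md` (card addendum v1.3, hazards H1–H6); edits = this header, the cell namespace `Summit.BirchSwinnertonDyer.Rank1Residual.F1Sign2`
in place of the workfile's `…Cruxes.BSDOfMainConjectureRankOneAtTwo.TypingDraft`, the `@[conjecture]` tags (cell convention for OPEN statements), the word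
DRAFT dropped from the two docstrings, the import list trimmed to the Literature modules the statements use, and ONE author-requested refinement
(bsd-line-att-p1 g2, HOME/INBOX.md 2026-08-28T02:32:12Z): T-23008-b's 2-adic clause is filed in NORM form `‖q·ε₂·Reg₂‖ = ‖ϖ·[T¹]L₂·log₂5‖`
(strictly weaker than the workfile's exact equality; the currency of K2-G′v; the crux's closure consumes only the norm, via `bsdp_of_normLeadingTerm_of_shaAnTransfer` p595859). CURRENCY (H1–H3/H6 of the card, ONE
consistent choice, load-bearing only jointly): `Dh.IsCanonicalSq` (tree Σ² receptacle; Stein–Wuthrich normalisation), `Reg₂ = padicRegulator Dh`,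
`log₂ γ = padicLog 2 (cyclotomicGenerator 2)`, `ε₂ = (1 − α⁻¹)²` on the `Ш` side in (a) and on the regulator side in (b), `ϖ` against `realPeriodRat`
(incl. `c_∞`). (a) = the body of the tree fact `Schneider1985_order_charGenerator` (`IwasawaLeadingTerm.lean` :166; BMS 2016 Thm 1.7, printed for
`p > 2`, tree-narrowed to `p ≥ 5`) with `5 ≤ p →` dropped, `p := 2`, `Dh.IsCanonical ↦ Dh.IsCanonicalSq` — hence NOT a Literature fact (no source
prints it at `2`: Schneider 1985's hypotheses at `2` unverified, REF2 want acq-00028). (b) = Perrin-Riou 1987 (p ∤ 2N) read at `2` on the cell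
(good ordinary at `2`, no rational 2-torsion, `r_an = 1`); its 2-adic Gross–Zagier leg is Disegni 2017 Thm B (allows `p = 2` with `2` split in
`K`) — in-print-assembly otherwise, not printed at `2` as a statement. CONVERGENCE NOTE (typer, HOME/INBOX.md 2026-08-28T01:40:37Z): the -es lens'
§14 objects K2-Gv `TwoAdicBSDValRankOneOrd` / K2-G′v `TwoAdicShaAnTransferRankOneOrd` (`HOME/data-es/g5/SketchG10.lean` 0dfd9a19d1874fbc) are
the ANALYTIC-side twins of (a)∘MC and (b) on the 23715 slice in the same currencies (norm form); their glue `Glue14Ord` is PROVED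
(`HOME/MEMO-ty-data/g4/SketchG10-plus-glue14Ord.lean` b8d4ff1c2a34dccb). REF1-AUDIT-v1 §58 (d867ccebf2d1fce2, 02:35:19Z; exact-form draft 0b06042c427236ee) + **§58b** (324170dac3caedf0, 02:37:14Z; evidence `HOME/REF1-data/b58/`; audited ON THIS draft 6bc918b424012a9d = the NORM form of (b) requested by its author att-p1 02:32:12Z): **T-23008-a `SchneiderLeadingTermAtTwoSq` and T-23008-b `PerrinRiouComparisonAtTwo` SURVIVE conjecture-grade at `2`; -ty CLEARED TO FILE at 6bc918b424012a9d — NO `4^r` rescaling.** (a) = tree fact `Schneider1985_order_charGenerator` with {`p ↦ 2`, `5 ≤ p →` dropped, `IsCanonical ↦ IsCanonicalSq`} and NOTHING else (token-identical, 257 = 257); (b) = Perrin-Riou's rank-one comparison, 2-adic clause in norm form (delta vs the att-p1 workfile = exactly four inserted `‖` tokens; not satisfiable by `0 = 0` under the hypotheses: `q ≠ 0` at `r_an = 1`, `Reg₂ ≠ 0`), `q` pinned by the archimedean clause (no junk `∃`); BC7 CLEAN ×2 (b-norm P1 16.2 s/P2 5.4/P2h 0.8/P3 4.0; a P1 13.3/P2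 3.4/P2h 3.4/P3 7.5); `Iff.rfl` glue definitional; interfaces pinned/inhabited (`SelmerDualData` strict & pinned, `nonempty_selmerDualData_holds`; Σ²-datum modulo `mazurTate_sigmaSq_existsUnique_two`); one currency with p596807; H1–H6 CLEAN (§55); H7 (from §57, docstring only, added below): (a) is on the STRICT-at-∞ dual. The only post-audit delta of this file vs 6bc918b424012a9d = this header slot + the two H7/`q`-pinned docstring sentences (no decl body touched). REF2-PLACEMENT: pending (L1 = BMS 2016 Thm 1.7 printed for p > 2, Schneider 1985 hypotheses at 2 unverified acq-00028; L2 = Perrin-Riou 1987 for p ∤ 2N, Disegni 2017 Thm B allows p = 2 with 2 split in K — per Lines/birth.md; REF2 line inserted when posted). PARTITION: none moved; beyond-print theorem: no.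
bears_on: `stmt-BirchSwinnertonDyer-23008` (stub L = L3 ∘ adapter(T-23008-a) ∘ T-23008-b, p594193 + p594549).
-/

set_option autoImplicit false

noncomputable section

open scoped Classical MatrixGroups ModularForm

open CongruenceSubgroup WeierstrassCurve Literature.NumberTheory.EllipticCurves
  Literature.NumberTheory.EllipticCurves.ModularForms Literature.NumberTheory.EllipticCurves.Greenberg1999

namespace Summit.BirchSwinnertonDyer.Rank1Residual.F1Sign2

/-- **T-23008-a `SchneiderLeadingTermAtTwoSq` (OPEN at `2`; typed from the C3′ lead's draft, body verbatim)** — Perrin-Riou–Schneider / BMS Thm 1.7 AT `p = 2`, over the `Σ²` height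
receptacle: for `W/ℚ` globally minimal, good ordinary at `2`, every cyclotomic datum, every torsion dual datum with characteristic
generator `f_E`, and THE canonical `2`-adic height `Dh` (`IsCanonicalSq`): (1) `rank ≤ ord_T f_E`; (2) `ord_T f_E = rank ↔
Reg₂(Dh) ≠ 0 ∧ Ш[2^∞] finite`; (3) then `[T^r]f_E · (log₂ 5)^r · tors² = u · (1 − α⁻¹)² · #Ш[2^∞] · Reg₂(Dh) · ∏ c_v`, `u ∈ ℤ₂ˣ`.
REF1 §58 H7: this statement is on the STRICT-at-`∞` Selmer dual (`SelmerDualData`, the tree's `D.X`) — the choice coherent with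
MC₂ on `D.X` and with BSD₂ in Néron currency for BOTH signs of `Δ_E` (the relaxed-at-`∞` dual would carry an extra `2` at `Δ_E > 0`,
REF1 §57). Open obligation (`@[conjecture]`); nothing asserted. [cite: BalakrishnanMullerStein2015, Thm. 1.7 (printed for p > 2; the p = 2 text is ours)]
[cite: Schneider1985, Thm. 2′ (hypotheses at p = 2 unverified)] -/
@[conjecture] def SchneiderLeadingTermAtTwoSq : Prop :=
  ∀ (W : WeierstrassCurve ℚ) [W.IsElliptic] [W.IsGloballyMinimal],
    W.HasGoodReductionAtPrime 2 → ¬ (2 : ℤ) ∣ W.frobeniusTrace 2 →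
    ∀ (κ : ZpExtension ℚ 2) (γ : Field.absoluteGaloisGroup ℚ),
      κ.IsCyclotomic → κ.IsTopGenerator γ → IsCyclotomicVariable 2 γ →
    ∀ (D : W.SelmerDualData κ γ) [Module.Finite (IwasawaAlgebra 2) D.X], D.IsTorsion →
    ∀ (fE : IwasawaAlgebra 2), D.charIdeal = Ideal.span {fE} →
    ∀ (Dh : PAdicHeightData W 2), Dh.IsCanonicalSq →
      (W.mordellWeilRank : ℕ∞) ≤ fE.order ∧
      (fE.order = W.mordellWeilRank ↔
        (SchneiderConjecture Dh ∧ Finite (AddCommGroup.primaryComponent W.sha 2))) ∧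
      (SchneiderConjecture Dh → Finite (AddCommGroup.primaryComponent W.sha 2) →
        ∃ u : ℤ_[2]ˣ,
          ((PowerSeries.coeff W.mordellWeilRank fE : ℤ_[2]) : ℚ_[2]) *
              padicLog 2 (cyclotomicGenerator 2) ^ W.mordellWeilRank * (W.torsionOrder : ℚ_[2]) ^ 2 =
            ((u : ℤ_[2]) : ℚ_[2]) *
              ((1 - (unitRoot W 2 : ℚ_[2])⁻¹) ^ 2 *
                ((Nat.card (AddCommGroup.primaryComponent W.sha 2) : ℚ_[2]) * padicRegulator Dh * W.tamagawaProduct)))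

/-- **T-23008-b `PerrinRiouComparisonAtTwo` (OPEN at `2`; typed from the C3′ lead's draft, body verbatim)** — Perrin-Riou's rank-one comparison AT `p = 2` on the cell: for `W/ℚ` globally
minimal, good ordinary at `2`, no rational `2`-torsion, `r_an = 1`, every conductor-level newform `f` and rational `ϖ` with
`ϖ · Ω_E = Ω⁺_f`, and THE canonical `2`-adic height `Dh` (`IsCanonicalSq`) with `Reg₂(Dh) ≠ 0`: ONE rational number `q` satisfies
`‖q · (1 − α⁻¹)² · Reg₂(Dh)‖₂ = ‖ϖ · [T¹]L₂(f, α) · log₂ 5‖₂` (NORM form — the author's refinement 2026-08-28T02:32:12Z: strictly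
weaker than the exact 2-adic equality, all that BSD₂ consumes) and `q · Ω_E · Reg_∞(E) = L′(E,1)` in `ℂ`. The rational `q` is PINNED by the archimedean clause
(`Ω_E · Reg_∞ ≠ 0` in rank one) — no junk `∃` (REF1 §58). Open obligation (`@[conjecture]`), currency as in (a); nothing asserted. [cite: PerrinRiou1987, Thm. (rank-one comparison; printed for p ∤ 2N)] [cite: Disegni2017, Thm. B (p-adic Gross–Zagier, p = 2 allowed with 2 split in K)] -/
@[conjecture] def PerrinRiouComparisonAtTwo : Prop :=
  ∀ (W : WeierstrassCurve ℚ) [W.IsElliptic] [W.IsGloballyMinimal],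
    IsOrdinaryAt W 2 → (∀ x : ℚ, ¬ HasRationalTwoTorsionX W x) → W.analyticRank = 1 →
    ∀ [NeZero (W.conductorNorm ℤ)] (f : CuspForm (Gamma0 (W.conductorNorm ℤ)) 2), IsNewformOf W f →
    ∀ (ϖ : ℚ), (ϖ : ℝ) * W.realPeriodRat = plusPeriod f →
    ∀ (Dh : PAdicHeightData W 2), Dh.IsCanonicalSq → SchneiderConjecture Dh →
      ∃ q : ℚ,
        ‖(q : ℚ_[2]) * ((1 - (unitRoot W 2 : ℚ_[2])⁻¹) ^ 2 * padicRegulator Dh)‖ =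
            ‖(ϖ : ℚ_[2]) * PowerSeries.coeff 1 (padicLFunction f (unitRoot W 2 : ℚ_[2])) *
              padicLog 2 (cyclotomicGenerator 2)‖ ∧
        (q : ℂ) * ((W.realPeriodRat : ℂ) * (W.regulator : ℂ)) = W.leadingLCoeff

/-! ## Typer glue (definitional): per-curve forms, so that cell-restricted versions quantify BY NAME over seeds -/

/-- Per-curve form of T-23008-a: `SchneiderLeadingTermAtTwoSq = ∀ W, SchneiderLeadingTermAtTwoSqAt W` (definitional, `schneiderLeadingTermAtTwoSq_iff`).
A predicate on `W`; nothing asserted. -/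
def SchneiderLeadingTermAtTwoSqAt (W : WeierstrassCurve ℚ) [W.IsElliptic] [W.IsGloballyMinimal] : Prop :=
  W.HasGoodReductionAtPrime 2 → ¬ (2 : ℤ) ∣ W.frobeniusTrace 2 →
  ∀ (κ : ZpExtension ℚ 2) (γ : Field.absoluteGaloisGroup ℚ),
    κ.IsCyclotomic → κ.IsTopGenerator γ → IsCyclotomicVariable 2 γ →
  ∀ (D : W.SelmerDualData κ γ) [Module.Finite (IwasawaAlgebra 2) D.X], D.IsTorsion →
  ∀ (fE : IwasawaAlgebra 2), D.charIdeal = Ideal.span {fE} →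
  ∀ (Dh : PAdicHeightData W 2), Dh.IsCanonicalSq →
    (W.mordellWeilRank : ℕ∞) ≤ fE.order ∧
    (fE.order = W.mordellWeilRank ↔
      (SchneiderConjecture Dh ∧ Finite (AddCommGroup.primaryComponent W.sha 2))) ∧
    (SchneiderConjecture Dh → Finite (AddCommGroup.primaryComponent W.sha 2) →
      ∃ u : ℤ_[2]ˣ,
        ((PowerSeries.coeff W.mordellWeilRank fE : ℤ_[2]) : ℚ_[2]) *
            padicLog 2 (cyclotomicGenerator 2) ^ W.mordellWeilRank * (W.torsionOrder : ℚ_[2]) ^ 2 =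
          ((u : ℤ_[2]) : ℚ_[2]) *
            ((1 - (unitRoot W 2 : ℚ_[2])⁻¹) ^ 2 *
              ((Nat.card (AddCommGroup.primaryComponent W.sha 2) : ℚ_[2]) * padicRegulator Dh * W.tamagawaProduct)))

/-- Per-curve form of T-23008-b: `PerrinRiouComparisonAtTwo = ∀ W, PerrinRiouComparisonAtTwoAt W` (definitional, `perrinRiouComparisonAtTwo_iff`).
A predicate on `W`; nothing asserted. -/
def PerrinRiouComparisonAtTwoAt (W : WeierstrassCurve ℚ) [W.IsElliptic] [W.IsGloballyMinimal] : Prop :=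
  IsOrdinaryAt W 2 → (∀ x : ℚ, ¬ HasRationalTwoTorsionX W x) → W.analyticRank = 1 →
  ∀ [NeZero (W.conductorNorm ℤ)] (f : CuspForm (Gamma0 (W.conductorNorm ℤ)) 2), IsNewformOf W f →
  ∀ (ϖ : ℚ), (ϖ : ℝ) * W.realPeriodRat = plusPeriod f →
  ∀ (Dh : PAdicHeightData W 2), Dh.IsCanonicalSq → SchneiderConjecture Dh →
    ∃ q : ℚ,
      ‖(q : ℚ_[2]) * ((1 - (unitRoot W 2 : ℚ_[2])⁻¹) ^ 2 * padicRegulator Dh)‖ =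
          ‖(ϖ : ℚ_[2]) * PowerSeries.coeff 1 (padicLFunction f (unitRoot W 2 : ℚ_[2])) *
            padicLog 2 (cyclotomicGenerator 2)‖ ∧
      (q : ℂ) * ((W.realPeriodRat : ℂ) * (W.regulator : ℂ)) = W.leadingLCoeff

/-- Unfolding (proved, `Iff.rfl`): the universal statement is the conjunction of its per-curve forms. -/
theorem schneiderLeadingTermAtTwoSq_iff :
    SchneiderLeadingTermAtTwoSq ↔
      ∀ (W : WeierstrassCurve ℚ) [W.IsElliptic] [W.IsGloballyMinimal], SchneiderLeadingTermAtTwoSqAt W :=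
  Iff.rfl

/-- Unfolding (proved, `Iff.rfl`): the universal statement is the conjunction of its per-curve forms. -/
theorem perrinRiouComparisonAtTwo_iff :
    PerrinRiouComparisonAtTwo ↔
      ∀ (W : WeierstrassCurve ℚ) [W.IsElliptic] [W.IsGloballyMinimal], PerrinRiouComparisonAtTwoAt W :=
  Iff.rfl

/-- Projection (proved): the universal statement gives the per-curve one. -/
theorem schneiderLeadingTermAtTwoSqAt_of (h : SchneiderLeadingTermAtTwoSq) (W : WeierstrassCurve ℚ) [W.IsElliptic]
    [W.IsGloballyMinimal] : SchneiderLeadingTermAtTwoSqAt W :=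
  h W

/-- Projection (proved): the universal statement gives the per-curve one. -/
theorem perrinRiouComparisonAtTwoAt_of (h : PerrinRiouComparisonAtTwo) (W : WeierstrassCurve ℚ) [W.IsElliptic]
    [W.IsGloballyMinimal] : PerrinRiouComparisonAtTwoAt W :=
  h W

end Summit.BirchSwinnertonDyer.Rank1Residual.F1Sign2

end
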